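import Literature.MathematicalPhysics.KineticTheory.HardSphereEulerSymmetricForm
import Literature.Analysis.PDE.SymmHyperbolicSmoothFamilies
import Literature.MathematicalPhysics.KineticTheory.HardSphereEulerSmoothFamilies
import Literature.Analysis.FunctionSpaces.TorusSpaceTime
import Literature.Analysis.FunctionSpaces.TorusCalculusProofs
import HarnessLib

/-!
# Smooth one-parameter families of classical hard-sphere Euler solutions at small packing, from
# the parameter-family local theory of symmetric hyperbolic systems (topic
# `MathematicalPhysics/KineticTheory`; everything proved, no definitions, no named facts)

MathematicalPhysics/KineticTheory support file `HardSphereEulerSmoothFamiliesOfSymmHyperbolic.lean` (companion of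
the statement file `HardSphereEulerSmoothFamilies.lean`, p833672, whose named fact
`hsEuler_smoothFamilyWellposedness` it DERIVES from the generic printed-shape fact — corollary
`hsEuler_smoothFamilyWellposedness_of_symmHyperbolic` at the end), the family analogue of
`HardSphereEulerLocalExistence.lean` (`hsEuler_localExistence_holds`, which runs the same
reduction for ONE datum against the PROVED theorem
`Literature.Analysis.PDE.symmHyperbolicLocalExistence_of_diagonal`). Here the input is the named
fact `Literature.Analysis.PDE.symmHyperbolic_smoothFamilies` (`SymmHyperbolicSmoothFamilies.lean`:
Kato 1975 Thms II–III / Valiente Kroon 2016 Thm 12.4 / Majda 1984 Thm 2.1 + Cor. 1, with the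
parameter principle, Hörmander 1997 p. 54 — common life span and joint `C^∞` dependence on a
parameter for quasilinear symmetric hyperbolic systems on `𝕋³`), taken as a hypothesis `(H : …)`,
and the output is the hard-sphere statement consumed by the hydrodynamic-limit problem
(`Summit.AtomisticToContinuum.HydrodynamicLimit.Theorems.PreShockDoor.SmoothFamilyWellposedness`,
the `[WD]` piece of the PreShockDoor node, stmt-AtomisticToContinuum-13621), stated verbatim as the
conclusion of `hsEuler_smoothFamilies_of_symmHyperbolic` (over Literature declarations only):
under the equation-of-state hypothesis (`hsExcessFreeEnergy = F` on `[0, η₀)`, `F` analytic on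
`(-η₀, η₀)`) there is `η₁ > 0` such that for every `σ > 0` and every family of smooth positive data
`(ρ₀, u₀, θ₀)(m, ·)`, `m ∈ [0,1]`, jointly `C^∞` in `(m, x)`, with packing `ρ₀σ³ ≤ η₁`, there are a
common `T > 0` and classical hard-sphere Euler solutions on `[0, T)` with these data, jointly `C^∞`
in `(m, t, x)` on `[0,1] × [0,T) × 𝕋³` (one-sided at `m = 0, 1`, `t = 0`, within the set).

Proof (Dafermos Thm 5.1.1, Steps 0 and 5, as in `hsEuler_localExistence_holds`): `η₁ = η_c/2`
with `η_c(η₀, F)` the packing threshold of `exists_packing_threshold`; for `σ > 0` the hard-sphere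
system in `V = (ρ, u, θ) ∈ ℝ⁵` has the symmetric form `hsSymA0`, `hsSymA` on the open state domain
`hsStateDomain σ η_c = {ρ > 0, θ > 0, ρσ³ < η_c}` (`contDiffOn_hsSymA0_hsSymA`, `posDef_hsSymA0`
via `deriv_hsPressure_density_ge`, `isSymm_hsSymA`); the packed data family
`m ↦ hsStateVec (ρ₀ m) (u₀ m) (θ₀ m)` is jointly smooth (coordinatewise, `contDiffOn_euclidean`)
and takes, for `(m, x) ∈ [0,1] × 𝕋³`, values in the compact image of `[0,1] × [0,1]³` under its
space–time lift (`Torus.isCompact_toLp_image_pi_Icc`, `Torus.proj_repr`), which lies in the state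
domain since `ρ₀σ³ ≤ η_c/2 < η_c`; the fact gives `T` and the family `V`; each member is a
classical hard-sphere Euler solution by `IsHardSphereEulerSolution.of_symmVector`, with the right
data (`hsStateVec_apply_zero/_four`, `hsVelPart_hsStateVec`), and the coordinates / velocity
part of the jointly smooth `V` are jointly smooth (`ContinuousLinearMap.contDiff.comp_contDiffOn`
with `EuclideanSpace.proj`, `hsVelPart`).

## Mathlib / tree search

Tree: `hsEuler_localExistence_holds` (`HardSphereEulerLocalExistence`, the single-datum twin),
`IsHardSphereEulerSolution.of_symmVector`, `hsStateVec`, `hsVelPart`, `hsStateDomain`,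
`contDiffOn_hsSymA0_hsSymA`, `posDef_hsSymA0`, `isSymm_hsSymA`, `exists_packing_threshold`,
`deriv_hsPressure_density_ge`, `deriv_hsPressure_density_eq_hsDpDrho`
(`HardSphereEulerSymmetricForm`, `HardSphereEulerLocalTheoryProofs`);
`Torus.IsSmoothSpaceTimeOn.apply`, `.continuousOn_stLift` (`TorusSpaceTime`),
`Torus.isCompact_toLp_image_pi_Icc`, `Torus.repr_mem_toLp_image_pi_Icc` (`TorusCalculusProofs`),
`Torus.proj_repr` (`FlatTorus`). Mathlib: `contDiffOn_euclidean`, `EuclideanSpace.proj`,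
`IsCompact.image_of_continuousOn`.

## References

* T. Kato, Arch. Rational Mech. Anal. 58 (1975) 181–205, Thms II–III. [`Kato1975`]
* J. A. Valiente Kroon, *Conformal Methods in General Relativity*, CUP 2016, Thm 12.4,
  pp. 330–331. [`Kroon2016`]
* C. M. Dafermos, *Hyperbolic Conservation Laws in Continuum Physics*, 2nd ed., Springer 2005,
  §5.1, Thm 5.1.1, p. 122. [`Dafermos2005`]
* L. Hörmander, *Lectures on Nonlinear Hyperbolic Differential Equations*, Springer 1997, §4.2,
  p. 54. [`Hormander1997`]
-/

noncomputable section

open Set Filter Topology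
open scoped ContDiff

namespace Literature.MathematicalPhysics.KineticTheory

open Literature.Analysis.FunctionSpaces Literature.Analysis.FunctionSpaces.Torus
open Literature.Analysis.PDE

/-- The packed data family `m ↦ (ρ₀, u₀, θ₀)(m) : 𝕋³ → ℝ⁵` of a jointly smooth family of
primitive data is jointly smooth in `(m, x)`. [folklore] -/
private theorem isSmoothSpaceTimeOn_hsStateVec {S : Set ℝ} {ρ₀ θ₀ : ℝ → T3 → ℝ} {u₀ : ℝ → T3 → V3}
    (hρ₀ : IsSmoothSpaceTimeOn S ρ₀) (hθ₀ : IsSmoothSpaceTimeOn S θ₀)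
    (hu₀ : IsSmoothSpaceTimeOn S u₀) :
    IsSmoothSpaceTimeOn S (fun m => hsStateVec (ρ₀ m) (u₀ m) (θ₀ m)) := by
  unfold IsSmoothSpaceTimeOn
  rw [contDiffOn_euclidean]
  intro i
  fin_cases i
  · exact hρ₀
  · exact hu₀.apply 0
  · exact hu₀.apply 1
  · exact hu₀.apply 2
  · exact hθ₀

/-- A jointly smooth family of data on a compact parameter set `S` takes its values
`(ρ₀, u₀, θ₀)(m, x)`, `m ∈ S`, in a compact subset of `ℝ⁵` (the image of `S × [0,1]³` under the
space–time lift). [folklore] -/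
private theorem exists_isCompact_range_hsStateVec {S : Set ℝ} (hS : IsCompact S) {W₀ : ℝ → T3 → EuclideanSpace ℝ (Fin 5)}
    (hW₀ : IsSmoothSpaceTimeOn S W₀) :
    ∃ K : Set (EuclideanSpace ℝ (Fin 5)), IsCompact K ∧ (∀ m ∈ S, ∀ x, W₀ m x ∈ K) ∧
      ∀ v ∈ K, ∃ m ∈ S, ∃ x, W₀ m x = v := by
  refine ⟨stLift W₀ '' (S ×ˢ ((WithLp.toLp 2) '' (Set.pi univ fun _ : Fin 3 => Icc (0 : ℝ) 1))),
    ?_, ?_, ?_⟩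
  · exact (hS.prod isCompact_toLp_image_pi_Icc).image_of_continuousOn
      (hW₀.continuousOn_stLift.mono (prod_mono Subset.rfl (subset_univ _)))
  · intro m hm x
    exact ⟨(m, repr x), ⟨hm, repr_mem_toLp_image_pi_Icc x⟩, by simp⟩
  · rintro _ ⟨⟨m, y⟩, ⟨hm, -⟩, rfl⟩
    exact ⟨m, hm, proj y, rfl⟩

/-- **Smooth one-parameter families of classical hard-sphere Euler solutions at small packing**
(the `[WD]` piece `SmoothFamilyWellposedness` of the PreShockDoor node of
`Summit.AtomisticToContinuum.HydrodynamicLimit`, over Literature declarations), from the named fact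
`symmHyperbolic_smoothFamilies` (Kato 1975 Thms II–III with the parameter principle) by
Dafermos's reduction of the Euler system to symmetric hyperbolic form at small packing.
[cite: Dafermos2005, Thm 5.1.1] [cite: Kato1975, Thms II–III] -/
theorem hsEuler_smoothFamilies_of_symmHyperbolic (H : symmHyperbolic_smoothFamilies) :
    ∀ η₀ : ℝ, 0 < η₀ → ∀ F : ℝ → ℝ, AnalyticOnNhd ℝ F (Ioo (-η₀) η₀) →
    EqOn hsExcessFreeEnergy F (Ico 0 η₀) →
    ∃ η₁ : ℝ, 0 < η₁ ∧ ∀ σ : ℝ, 0 < σ →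
      ∀ (ρ₀ θ₀ : ℝ → T3 → ℝ) (u₀ : ℝ → T3 → V3),
        Torus.IsSmoothSpaceTimeOn (Icc 0 1) ρ₀ → Torus.IsSmoothSpaceTimeOn (Icc 0 1) θ₀ →
        Torus.IsSmoothSpaceTimeOn (Icc 0 1) u₀ →
        (∀ m ∈ Icc (0:ℝ) 1, ∀ x, 0 < ρ₀ m x) → (∀ m ∈ Icc (0:ℝ) 1, ∀ x, 0 < θ₀ m x) →
        (∀ m ∈ Icc (0:ℝ) 1, ∀ x, ρ₀ m x * σ ^ 3 ≤ η₁) →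
        ∃ T : ℝ, 0 < T ∧ ∃ (ρ θ : ℝ → ℝ → T3 → ℝ) (u : ℝ → ℝ → T3 → V3),
          (∀ m ∈ Icc (0:ℝ) 1, IsHardSphereEulerSolution σ T (ρ m) (u m) (θ m) ∧
            ρ m 0 = ρ₀ m ∧ u m 0 = u₀ m ∧ θ m 0 = θ₀ m) ∧
          ContDiffOn ℝ ∞ (fun q : ℝ × ℝ × EuclideanSpace ℝ (Fin 3) => ρ q.1 q.2.1 (Torus.proj q.2.2))
            (Icc 0 1 ×ˢ (Ico 0 T ×ˢ univ)) ∧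
          ContDiffOn ℝ ∞ (fun q : ℝ × ℝ × EuclideanSpace ℝ (Fin 3) => u q.1 q.2.1 (Torus.proj q.2.2))
            (Icc 0 1 ×ˢ (Ico 0 T ×ˢ univ)) ∧
          ContDiffOn ℝ ∞ (fun q : ℝ × ℝ × EuclideanSpace ℝ (Fin 3) => θ q.1 q.2.1 (Torus.proj q.2.2))
            (Icc 0 1 ×ˢ (Ico 0 T ×ˢ univ)) := by
  intro η₀ hη₀ F hFa hF
  obtain ⟨η_c, hc0, hcη₀, hc⟩ := exists_packing_threshold hη₀ hFa
  refine ⟨η_c / 2, by positivity, fun σ hσ ρ₀ θ₀ u₀ hρ₀ hθ₀ hu₀ hρ₀pos hθ₀pos hpack₀ => ?_⟩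
  -- hypotheses of the matrix-form theory on `𝒪 = {ρ > 0, θ > 0, ρσ³ < η_c}`
  obtain ⟨hA0s, hAs⟩ := contDiffOn_hsSymA0_hsSymA (F := F) hFa hσ.le hcη₀.le (σ := σ)
  have hPD : ∀ v ∈ hsStateDomain σ η_c, (hsSymA0 F σ v).PosDef := by
    intro v hv
    have hvpack : v 0 * σ ^ 3 ∈ Ioo 0 η₀ := ⟨mul_pos hv.1 (pow_pos hσ 3), hv.2.2.trans hcη₀⟩
    have hge := deriv_hsPressure_density_ge hFa hF hc hv.2.1 hvpack hv.2.2.le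
    rw [deriv_hsPressure_density_eq_hsDpDrho hFa hF _ hvpack] at hge
    have hθ : 0 < v 4 := hv.2.1
    exact posDef_hsSymA0 F σ hv.1 hv.2.1 (lt_of_lt_of_le (by linarith) hge)
  have hSy : ∀ k, ∀ v ∈ hsStateDomain σ η_c, (hsSymA F σ k v).IsSymm := fun k v _ =>
    isSymm_hsSymA F σ k v
  -- the data family
  set W₀ : ℝ → T3 → EuclideanSpace ℝ (Fin 5) := fun m => hsStateVec (ρ₀ m) (u₀ m) (θ₀ m) with hW₀
  have hW₀s : IsSmoothSpaceTimeOn (Icc 0 1) W₀ := isSmoothSpaceTimeOn_hsStateVec hρ₀ hθ₀ hu₀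
  have hK : ∃ K, IsCompact K ∧ K ⊆ hsStateDomain σ η_c ∧ ∀ m ∈ Icc (0 : ℝ) 1, ∀ x, W₀ m x ∈ K := by
    obtain ⟨K, hKc, hKmem, hKsub⟩ := exists_isCompact_range_hsStateVec isCompact_Icc hW₀s
    refine ⟨K, hKc, ?_, hKmem⟩
    intro v hv
    obtain ⟨m, hm, x, rfl⟩ := hKsub v hv
    refine ⟨?_, ?_, ?_⟩
    · simpa [hW₀] using hρ₀pos m hm x
    · simpa [hW₀] using hθ₀pos m hm x
    · have h := hpack₀ m hm x
      simp only [hW₀, hsStateVec_apply_zero]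
      linarith
  obtain ⟨T, hT, V, hVm, hJ⟩ := H 5 (hsStateDomain σ η_c) (hsSymA0 F σ) (hsSymA F σ)
    (isOpen_hsStateDomain σ η_c) hA0s hAs hPD hSy W₀ hW₀s hK
  refine ⟨T, hT, fun m t x => V m t x 0, fun m t x => V m t x 4,
    fun m t x => hsVelPart (V m t x), ?_, ?_, ?_, ?_⟩
  · intro m hm
    obtain ⟨hV, hV0, hVO, hEq⟩ := hVm m hm
    refine ⟨IsHardSphereEulerSolution.of_symmVector hFa hF hcη₀ hc hσ hV hVO hEq, ?_, ?_, ?_⟩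
    · funext x
      simp [hV0, hW₀]
    · funext x
      simp [hV0, hW₀]
    · funext x
      simp [hV0, hW₀]
  · exact (EuclideanSpace.proj (0 : Fin 5) : EuclideanSpace ℝ (Fin 5) →L[ℝ] ℝ).contDiff.comp_contDiffOn hJ
  · exact (hsVelPart).contDiff.comp_contDiffOn hJ
  · exact (EuclideanSpace.proj (4 : Fin 5) : EuclideanSpace ℝ (Fin 5) →L[ℝ] ℝ).contDiff.comp_contDiffOn hJ

/-- **The landed hard-sphere named fact is an instance of the generic one.**
`hsEuler_smoothFamilyWellposedness` (p833672, `HardSphereEulerSmoothFamilies.lean`; statement =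
the door hypothesis `[WD]` verbatim) follows from the printed-shape fact
`Literature.Analysis.PDE.symmHyperbolic_smoothFamilies` — so the dependence OF RECORD of the
`PreShockHomotopy` door is the generic Kato-type fact, and the hard-sphere fact is derived.
[cite: Kato1975, Thms II–III] [cite: Dafermos2005, Thm 5.1.1] -/
theorem hsEuler_smoothFamilyWellposedness_of_symmHyperbolic
    (H : Literature.Analysis.PDE.symmHyperbolic_smoothFamilies) :
    hsEuler_smoothFamilyWellposedness :=
  hsEuler_smoothFamilies_of_symmHyperbolic H

end Literature.MathematicalPhysics.KineticTheory

end
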